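import Mathlib
import HarnessLib
import Literature.Topology.FourManifolds.BalancedPresentationMoves
import Literature.Topology.FourManifolds.TriangularPresentationAndrewsCurtis

/-!
# KillerPresentationAC (decomp-sp4 lens-3 gen 14, THEOREM B — algebraic half, kernel-certified for ALL band words)

Theorems-lane text (writer g5): namespace `…Theorems.KillerPresentationAC` (lens record used `…Theses.KillerLength.AC`); the two
`#guard_msgs … #print axioms` guards of the record are dropped here (the gate audit reports axioms); the record’s re-proved copies of the two tree
moves are replaced by the import of `TriangularPresentationAndrewsCurtis` (gate `dedup.landed`, lander 989 lesson); nothing else changed.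
Supports stmt-SmoothPoincare4-28014 (C.StableMirrorCancellation): decides the length-3 killer rows (NODE-v14 §3).

For every word `w` in the free group on `a = x₀`, `b = x₁`, the balanced presentations of the trivial group
  `P_w  = ⟨a, b ∣ w a w⁻¹ b⁻¹, a² b⁻¹⟩`   and   `P'_w = ⟨a, b ∣ w a w⁻¹ b⁻¹, b² a⁻¹⟩`
— the fusion-one ribbon 2-knot group `π_w = ⟨a, b ∣ w a w⁻¹ = b⟩` together with the length-three killer
`γ = a² b⁻¹` (resp. `b² a⁻¹`) — are ANDREWS–CURTIS TRIVIAL (the three moves of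
`Literature.Topology.FourManifolds.IsAndrewsCurtisEquivalent`, no stabilisation).
Proof: the substitution `b ↦ a²` (resp. `a ↦ b²`) is realised on the first relator by multiplying it with a
consequence of the second (tree: `IsAndrewsCurtisEquivalent.update_mul_of_mem_normalClosure`, imported); it turns
`w a w⁻¹ b⁻¹` into `a⁻¹` (resp. `b`), after which two more consequences and inversions reach `⟨a, b ∣ a, b⟩`.
Combined with the tree's named fact
`Literature.Topology.FourManifolds.IsPresentationHandlebodyFive.nonempty_diffeomorph_closedBall_of_isStablyAndrewsCurtisEquivalent`
(Andrews–Curtis 1965: `H⁵(P, ε) ≅ B⁵` for AC-trivial `P`) and the paper identification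
`M(K_w, γ, ε) = ∂H⁵(P_{w,γ}, ε)` (NODE-v14 §3 Lemma D: `S⁴` surgered along the ribbon double `K_w` is `∂(E_{D_w} × I)`),
this decides the whole LENGTH-3 COLUMN of the census T-KILLER-R (608 groups): all those homotopy 4-spheres are `S⁴`.
-/

set_option linter.dupNamespace false

namespace Summit.SmoothPoincare4.SmoothPoincare4.Theorems.KillerPresentationAC

open Literature.Topology.FourManifolds Function


/-! The two derived Andrews–Curtis moves used below, `IsAndrewsCurtisEquivalent.update_mul_conj` and
`IsAndrewsCurtisEquivalent.update_mul_of_mem_normalClosure`, are the TREE’s (`Literature/Topology/FourManifolds/TriangularPresentationAndrewsCurtis.lean`),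
imported by name (gate rule `dedup.landed`: no re-proved copies of landed declarations). -/

/-- `P_w = ⟨a, b ∣ w a w⁻¹ b⁻¹, a a b⁻¹⟩` (group of the fusion-one ribbon 2-knot `K_w` + killer `a²b⁻¹`). -/
def killerPresA (w : FreeGroup (Fin 2)) : BalancedPresentation 2 :=
  ![w * FreeGroup.of 0 * w⁻¹ * (FreeGroup.of 1)⁻¹, FreeGroup.of 0 * FreeGroup.of 0 * (FreeGroup.of 1)⁻¹]

/-- `P'_w = ⟨a, b ∣ w a w⁻¹ b⁻¹, b b a⁻¹⟩` (killer `b²a⁻¹`). -/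
def killerPresB (w : FreeGroup (Fin 2)) : BalancedPresentation 2 :=
  ![w * FreeGroup.of 0 * w⁻¹ * (FreeGroup.of 1)⁻¹, FreeGroup.of 1 * FreeGroup.of 1 * (FreeGroup.of 0)⁻¹]

/-- KERNEL OF A SUBSTITUTION: if `xⱼ⁻¹ · f xⱼ ∈ N` for every generator and `N` is normal, then
`w⁻¹ · (lift f) w ∈ N` for every word `w`. -/
theorem inv_mul_lift_mem {n : ℕ} (f : Fin n → FreeGroup (Fin n)) (N : Subgroup (FreeGroup (Fin n)))
    [hN : N.Normal] (hf : ∀ j, (FreeGroup.of j)⁻¹ * f j ∈ N) (w : FreeGroup (Fin n)) :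
    w⁻¹ * FreeGroup.lift f w ∈ N := by
  induction w with
  | C1 => simp [N.one_mem]
  | of x => simpa [FreeGroup.lift_apply_of] using hf x
  | inv_of x _ =>
    rw [inv_inv, map_inv, FreeGroup.lift_apply_of]
    have h1 : (f x)⁻¹ * FreeGroup.of x ∈ N := by
      have := N.inv_mem (hf x)
      simpa [mul_inv_rev] using this
    have h2 := hN.conj_mem _ h1 (FreeGroup.of x)
    simpa [mul_assoc] using h2
  | mul u v hu hv =>
    have eq : (u * v)⁻¹ * FreeGroup.lift f (u * v) =
        v⁻¹ * (u⁻¹ * FreeGroup.lift f u) * v⁻¹⁻¹ * (v⁻¹ * FreeGroup.lift f v) := by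
      rw [map_mul]; group
    rw [eq]
    exact N.mul_mem (hN.conj_mem _ hu v⁻¹) hv

/-- RANGE OF A SUBSTITUTION INTO POWERS: if every `f xⱼ` is a power of `c`, so is `(lift f) w`. -/
theorem lift_mem_zpowers {n : ℕ} (f : Fin n → FreeGroup (Fin n)) (c : FreeGroup (Fin n))
    (hf : ∀ j, f j ∈ Subgroup.zpowers c) (w : FreeGroup (Fin n)) :
    FreeGroup.lift f w ∈ Subgroup.zpowers c :=
  FreeGroup.range_lift_le (s := Subgroup.zpowers c) (by rintro _ ⟨j, rfl⟩; exact hf j) ⟨w, rfl⟩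

/-- The substitution `σ : a ↦ a, b ↦ a²`. -/
def substA : Fin 2 → FreeGroup (Fin 2) := ![FreeGroup.of 0, FreeGroup.of 0 * FreeGroup.of 0]

/-- The substitution `σ' : a ↦ b², b ↦ b`. -/
def substB : Fin 2 → FreeGroup (Fin 2) := ![FreeGroup.of 1 * FreeGroup.of 1, FreeGroup.of 1]

/-- `σ(a) = a` (definitional). -/
theorem substA_zero : substA 0 = FreeGroup.of 0 := rfl
/-- `σ(b) = a²` (definitional). -/
theorem substA_one : substA 1 = FreeGroup.of 0 * FreeGroup.of 0 := rfl
/-- `σ'(a) = b²` (definitional). -/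
theorem substB_zero : substB 0 = FreeGroup.of 1 * FreeGroup.of 1 := rfl
/-- `σ'(b) = b` (definitional). -/
theorem substB_one : substB 1 = FreeGroup.of 1 := rfl

/-- `σ(w)` is a power of `a` for every word `w`. -/
theorem substA_mem_zpowers (w : FreeGroup (Fin 2)) :
    FreeGroup.lift substA w ∈ Subgroup.zpowers (FreeGroup.of (0 : Fin 2)) := by
  refine lift_mem_zpowers substA _ (fun j => ?_) w
  fin_cases j
  · exact Subgroup.mem_zpowers _
  · exact (Subgroup.zpowers _).mul_mem (Subgroup.mem_zpowers _) (Subgroup.mem_zpowers _)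

/-- `σ'(w)` is a power of `b` for every word `w`. -/
theorem substB_mem_zpowers (w : FreeGroup (Fin 2)) :
    FreeGroup.lift substB w ∈ Subgroup.zpowers (FreeGroup.of (1 : Fin 2)) := by
  refine lift_mem_zpowers substB _ (fun j => ?_) w
  fin_cases j
  · exact (Subgroup.zpowers _).mul_mem (Subgroup.mem_zpowers _) (Subgroup.mem_zpowers _)
  · exact Subgroup.mem_zpowers _

/-- `σ(w)` commutes with `a`. -/
theorem substA_comm (w : FreeGroup (Fin 2)) :
    FreeGroup.lift substA w * FreeGroup.of 0 = FreeGroup.of 0 * FreeGroup.lift substA w := by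
  obtain ⟨k, hk⟩ := Subgroup.mem_zpowers_iff.mp (substA_mem_zpowers w)
  rw [← hk]
  exact (Commute.self_zpow (FreeGroup.of (0 : Fin 2)) k).symm.eq

/-- `σ'(w)` commutes with `b`. -/
theorem substB_comm (w : FreeGroup (Fin 2)) :
    FreeGroup.lift substB w * FreeGroup.of 1 = FreeGroup.of 1 * FreeGroup.lift substB w := by
  obtain ⟨k, hk⟩ := Subgroup.mem_zpowers_iff.mp (substB_mem_zpowers w)
  rw [← hk]
  exact (Commute.self_zpow (FreeGroup.of (1 : Fin 2)) k).symm.eq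

/-- The defect `w⁻¹ σ(w)` lies in the normal closure of `a a b⁻¹`. -/
theorem inv_mul_substA_mem (w : FreeGroup (Fin 2)) :
    w⁻¹ * FreeGroup.lift substA w ∈
      Subgroup.normalClosure ({FreeGroup.of 0 * FreeGroup.of 0 * (FreeGroup.of 1)⁻¹} : Set (FreeGroup (Fin 2))) := by
  set N := Subgroup.normalClosure
    ({FreeGroup.of 0 * FreeGroup.of 0 * (FreeGroup.of 1)⁻¹} : Set (FreeGroup (Fin 2))) with hN
  have hNn : N.Normal := Subgroup.normalClosure_normal
  have hr : FreeGroup.of 0 * FreeGroup.of 0 * (FreeGroup.of 1)⁻¹ ∈ N := Subgroup.subset_normalClosure rfl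
  refine inv_mul_lift_mem substA N (fun j => ?_) w
  fin_cases j
  · simp [substA_zero, N.one_mem]
  · -- `b⁻¹ (a a) = b⁻¹ (a a b⁻¹) b⁻¹⁻¹`
    have h := hNn.conj_mem _ hr (FreeGroup.of 1)⁻¹
    have e : (FreeGroup.of 1)⁻¹ * (FreeGroup.of 0 * FreeGroup.of 0 * (FreeGroup.of 1)⁻¹) * (FreeGroup.of 1)⁻¹⁻¹
        = (FreeGroup.of (1 : Fin 2))⁻¹ * (FreeGroup.of 0 * FreeGroup.of 0) := by group
    rw [e] at h
    simpa [substA_one] using h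

/-- The defect `w⁻¹ σ'(w)` lies in the normal closure of `b b a⁻¹`. -/
theorem inv_mul_substB_mem (w : FreeGroup (Fin 2)) :
    w⁻¹ * FreeGroup.lift substB w ∈
      Subgroup.normalClosure ({FreeGroup.of 1 * FreeGroup.of 1 * (FreeGroup.of 0)⁻¹} : Set (FreeGroup (Fin 2))) := by
  set N := Subgroup.normalClosure
    ({FreeGroup.of 1 * FreeGroup.of 1 * (FreeGroup.of 0)⁻¹} : Set (FreeGroup (Fin 2))) with hN
  have hNn : N.Normal := Subgroup.normalClosure_normal
  have hr : FreeGroup.of 1 * FreeGroup.of 1 * (FreeGroup.of 0)⁻¹ ∈ N := Subgroup.subset_normalClosure rfl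
  refine inv_mul_lift_mem substB N (fun j => ?_) w
  fin_cases j
  · have h := hNn.conj_mem _ hr (FreeGroup.of 0)⁻¹
    have e : (FreeGroup.of 0)⁻¹ * (FreeGroup.of 1 * FreeGroup.of 1 * (FreeGroup.of 0)⁻¹) * (FreeGroup.of 0)⁻¹⁻¹
        = (FreeGroup.of (0 : Fin 2))⁻¹ * (FreeGroup.of 1 * FreeGroup.of 1) := by group
    rw [e] at h
    simpa [substB_zero] using h
  · simp [substB_one, N.one_mem]

/-- **THEOREM B, algebraic half (killer `a²b⁻¹`)**: `⟨a, b ∣ w a w⁻¹ b⁻¹, a² b⁻¹⟩` is Andrews–Curtis trivial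
for every word `w`. -/
theorem killerPresA_ac_trivial (w : FreeGroup (Fin 2)) :
    IsAndrewsCurtisEquivalent (killerPresA w) (BalancedPresentation.trivial 2) := by
  set P0 := killerPresA w with hP0
  have hP00 : P0 0 = w * FreeGroup.of 0 * w⁻¹ * (FreeGroup.of 1)⁻¹ := rfl
  have hP01 : P0 1 = FreeGroup.of 0 * FreeGroup.of 0 * (FreeGroup.of 1)⁻¹ := rfl
  -- Step 1: substitute `b ↦ a²` in `r₀` by multiplying with a consequence of `r₁`; result `a⁻¹`.
  set g := (P0 0)⁻¹ * FreeGroup.lift substA (P0 0) with hg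
  have hgmem : g ∈ Subgroup.normalClosure (P0 '' ({1} : Set (Fin 2))) := by
    rw [Set.image_singleton, hP01]
    exact inv_mul_substA_mem (P0 0)
  have h01 : (0 : Fin 2) ∉ ({1} : Set (Fin 2)) := by simp
  have s1 := IsAndrewsCurtisEquivalent.update_mul_of_mem_normalClosure P0 h01 hgmem
  have e1 : P0 0 * g = (FreeGroup.of 0)⁻¹ := by
    rw [hg, mul_inv_cancel_left, hP00]
    simp only [map_mul, map_inv, FreeGroup.lift_apply_of, substA_zero, substA_one]
    rw [substA_comm w]
    group
  rw [e1] at s1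
  set P1 : BalancedPresentation 2 := update P0 0 (FreeGroup.of 0)⁻¹ with hP1
  -- Step 2: invert `r₀`.
  have s2 : IsAndrewsCurtisEquivalent P1 (update P1 0 (P1 0)⁻¹) :=
    (AndrewsCurtisMove.inv P1 0).isAndrewsCurtisEquivalent
  have eP2 : update P1 0 (P1 0)⁻¹ = update P0 0 (FreeGroup.of 0) := by
    rw [hP1, update_self, inv_inv, update_idem]
  rw [eP2] at s2
  set P2 : BalancedPresentation 2 := update P0 0 (FreeGroup.of 0) with hP2
  have hP20 : P2 0 = FreeGroup.of 0 := by rw [hP2, update_self]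
  have hP21 : P2 1 = FreeGroup.of 0 * FreeGroup.of 0 * (FreeGroup.of 1)⁻¹ := by
    rw [hP2, update_of_ne (by decide), hP01]
  -- Step 3: kill `a` inside `r₁`: multiply by `b (a a)⁻¹ b⁻¹ ∈ ⟪a⟫`; result `b⁻¹`.
  set g' : FreeGroup (Fin 2) := FreeGroup.of 1 * (FreeGroup.of 0 * FreeGroup.of 0)⁻¹ * (FreeGroup.of 1)⁻¹
    with hg'
  have hg'mem : g' ∈ Subgroup.normalClosure (P2 '' ({0} : Set (Fin 2))) := by
    rw [Set.image_singleton, hP20]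
    have hN : (Subgroup.normalClosure ({FreeGroup.of 0} : Set (FreeGroup (Fin 2)))).Normal :=
      Subgroup.normalClosure_normal
    have ha : FreeGroup.of 0 ∈ Subgroup.normalClosure ({FreeGroup.of 0} : Set (FreeGroup (Fin 2))) :=
      Subgroup.subset_normalClosure rfl
    have haa : (FreeGroup.of 0 * FreeGroup.of 0)⁻¹ ∈
        Subgroup.normalClosure ({FreeGroup.of 0} : Set (FreeGroup (Fin 2))) :=
      Subgroup.inv_mem _ (Subgroup.mul_mem _ ha ha)
    have := hN.conj_mem _ haa (FreeGroup.of 1)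
    simpa [hg', mul_assoc] using this
  have h10 : (1 : Fin 2) ∉ ({0} : Set (Fin 2)) := by simp
  have s3 := IsAndrewsCurtisEquivalent.update_mul_of_mem_normalClosure P2 h10 hg'mem
  have e3 : P2 1 * g' = (FreeGroup.of 1)⁻¹ := by rw [hP21, hg']; group
  rw [e3] at s3
  set P3 : BalancedPresentation 2 := update P2 1 (FreeGroup.of 1)⁻¹ with hP3
  -- Step 4: invert `r₁`; the result is the trivial presentation.
  have s4 : IsAndrewsCurtisEquivalent P3 (update P3 1 (P3 1)⁻¹) :=
    (AndrewsCurtisMove.inv P3 1).isAndrewsCurtisEquivalent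
  have eT : update P3 1 (P3 1)⁻¹ = BalancedPresentation.trivial 2 := by
    funext i
    fin_cases i
    · simp [hP3, hP2, BalancedPresentation.trivial]
    · simp [hP3, BalancedPresentation.trivial]
  rw [eT] at s4
  exact s1.trans (s2.trans (s3.trans s4))

/-- **THEOREM B, algebraic half (killer `b²a⁻¹`)**: `⟨a, b ∣ w a w⁻¹ b⁻¹, b² a⁻¹⟩` is Andrews–Curtis trivial
for every word `w`. -/
theorem killerPresB_ac_trivial (w : FreeGroup (Fin 2)) :
    IsAndrewsCurtisEquivalent (killerPresB w) (BalancedPresentation.trivial 2) := by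
  set P0 := killerPresB w with hP0
  have hP00 : P0 0 = w * FreeGroup.of 0 * w⁻¹ * (FreeGroup.of 1)⁻¹ := rfl
  have hP01 : P0 1 = FreeGroup.of 1 * FreeGroup.of 1 * (FreeGroup.of 0)⁻¹ := rfl
  -- Step 1: substitute `a ↦ b²` in `r₀`; result `b`.
  set g := (P0 0)⁻¹ * FreeGroup.lift substB (P0 0) with hg
  have hgmem : g ∈ Subgroup.normalClosure (P0 '' ({1} : Set (Fin 2))) := by
    rw [Set.image_singleton, hP01]
    exact inv_mul_substB_mem (P0 0)
  have h01 : (0 : Fin 2) ∉ ({1} : Set (Fin 2)) := by simp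
  have s1 := IsAndrewsCurtisEquivalent.update_mul_of_mem_normalClosure P0 h01 hgmem
  have hc2 : FreeGroup.lift substB w * (FreeGroup.of 1 * FreeGroup.of 1) =
      FreeGroup.of 1 * FreeGroup.of 1 * FreeGroup.lift substB w := by
    rw [← mul_assoc, substB_comm w, mul_assoc, substB_comm w, ← mul_assoc]
  have e1 : P0 0 * g = FreeGroup.of 1 := by
    rw [hg, mul_inv_cancel_left, hP00]
    simp only [map_mul, map_inv, FreeGroup.lift_apply_of, substB_zero, substB_one]
    rw [hc2]
    group
  rw [e1] at s1
  set P1 : BalancedPresentation 2 := update P0 0 (FreeGroup.of 1) with hP1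
  have hP10 : P1 0 = FreeGroup.of 1 := by rw [hP1, update_self]
  have hP11 : P1 1 = FreeGroup.of 1 * FreeGroup.of 1 * (FreeGroup.of 0)⁻¹ := by
    rw [hP1, update_of_ne (by decide), hP01]
  -- Step 2: kill `b` inside `r₁`: multiply by `a (b b)⁻¹ a⁻¹ ∈ ⟪b⟫`; result `a⁻¹`.
  set g' : FreeGroup (Fin 2) := FreeGroup.of 0 * (FreeGroup.of 1 * FreeGroup.of 1)⁻¹ * (FreeGroup.of 0)⁻¹
    with hg'
  have hg'mem : g' ∈ Subgroup.normalClosure (P1 '' ({0} : Set (Fin 2))) := by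
    rw [Set.image_singleton, hP10]
    have hN : (Subgroup.normalClosure ({FreeGroup.of 1} : Set (FreeGroup (Fin 2)))).Normal :=
      Subgroup.normalClosure_normal
    have hb : FreeGroup.of 1 ∈ Subgroup.normalClosure ({FreeGroup.of 1} : Set (FreeGroup (Fin 2))) :=
      Subgroup.subset_normalClosure rfl
    have hbb : (FreeGroup.of 1 * FreeGroup.of 1)⁻¹ ∈
        Subgroup.normalClosure ({FreeGroup.of 1} : Set (FreeGroup (Fin 2))) :=
      Subgroup.inv_mem _ (Subgroup.mul_mem _ hb hb)
    have := hN.conj_mem _ hbb (FreeGroup.of 0)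
    simpa [hg', mul_assoc] using this
  have h10 : (1 : Fin 2) ∉ ({0} : Set (Fin 2)) := by simp
  have s2 := IsAndrewsCurtisEquivalent.update_mul_of_mem_normalClosure P1 h10 hg'mem
  have e2 : P1 1 * g' = (FreeGroup.of 0)⁻¹ := by rw [hP11, hg']; group
  rw [e2] at s2
  set P2 : BalancedPresentation 2 := update P1 1 (FreeGroup.of 0)⁻¹ with hP2
  -- Step 3: invert `r₁`; the result is `⟨a, b ∣ b, a⟩`, the trivial presentation with relators SWAPPED.
  have s3 : IsAndrewsCurtisEquivalent P2 (update P2 1 (P2 1)⁻¹) :=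
    (AndrewsCurtisMove.inv P2 1).isAndrewsCurtisEquivalent
  have eS : update P2 1 (P2 1)⁻¹ = (BalancedPresentation.trivial 2) ∘ ⇑(Equiv.swap (0 : Fin 2) 1) := by
    funext i
    fin_cases i
    · simp [hP2, hP1, BalancedPresentation.trivial, Equiv.swap_apply_left]
    · simp [hP2, BalancedPresentation.trivial, Equiv.swap_apply_right]
  rw [eS] at s3
  -- Step 4: un-swap (relator permutations are Andrews–Curtis equivalences, tree `comp_swap`).
  have s4 : IsAndrewsCurtisEquivalent ((BalancedPresentation.trivial 2) ∘ ⇑(Equiv.swap (0 : Fin 2) 1))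
      (BalancedPresentation.trivial 2) :=
    (IsAndrewsCurtisEquivalent.comp_swap (BalancedPresentation.trivial 2) 0 1).symm
  exact s1.trans (s2.trans (s3.trans s4))

/-- Packaging for the record: both length-three killers, every band word. -/
theorem lengthThree_killer_presentations_ac_trivial (w : FreeGroup (Fin 2)) :
    IsAndrewsCurtisEquivalent (killerPresA w) (BalancedPresentation.trivial 2) ∧
      IsAndrewsCurtisEquivalent (killerPresB w) (BalancedPresentation.trivial 2) :=
  ⟨killerPresA_ac_trivial w, killerPresB_ac_trivial w⟩

end Summit.SmoothPoincare4.SmoothPoincare4.Theorems.KillerPresentationAC
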